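import Summits.Parity.GeneralizedHardyLittlewood.Theorems.PrimeLevelFamEdgeMomentsBeyondDiagonalLayersClassGenericB
import Summits.Parity.GeneralizedHardyLittlewood.Theorems.PrimeLevelFamEdgeMomentsBeyondDiagonalLayersClassFacts
import HarnessLib

/-!
# Route `PrimeLevelFamEdge`, crux K_A `MomentsBeyondDiagonal` (stmt-Parity-20007), line «petersson_layers» v4:
# the class weights of the UNIFORM per-class bound (assembly step E5b, scalar part)

The closed-form per-class bounds of the line (`…LayersClassBoundAll` for Pascadi's two orderings, CONDITIONAL;
`…LayersClassBoundFourier`, unconditional) are products of the `ℓ²` sizes `B²√(Z₁Z₂)`, `KL√((1+2log q)·Y/(d₁t₁d₂t₂))`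
with a kernel factor.  This file evaluates those products against ONE uniform right-hand side
`√(1+2log q) · x^{Δ'+1+η/2−13/600} · (qr)^{1+ε} · (d₁d₂)⁻¹ · (s₁t₁s₂t₂)^{−1/12}` (`x = q̂`):
* `sqrt_flatBox_le` (`√(Z₁Z₂) ≤ x^{Δ'}/√(d₁d₂·s₁s₂)`), `sqrt_afeBox_le` (`√((1+2log q)Y/(d₁t₁d₂t₂)) ≤ √(1+2log q)√2x^{1+η/2}/√(d₁d₂·t₁t₂)`);
* `weight_key_le` (`u^{1/3}g^{1/6} ≤ P^{5/12}` for `u ≤ P`, `g² ≤ P`), `sqrt_add_one_le`;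
* **`pascadi_weight_le`**: the Pascadi kernel factor `g·(qr/g)^{1+ε}·bracket^{1/6}` with `bracket ≤ 3u²g·x^{−13/100}`
  (`u = t₁` in the ordering `σ₂'V ≤ σ₁'Z₁Z₂`, `u = s₂` in the other — `…LayersClassGeneric(B)`) gives the uniform bound with constant `6`;
* **`fourier_weight_le`**: the dilated-Parseval kernel factor `g·(qr/g)·√(m₁+1)·√(m₂+1)` with `m₁ ≤ x^{2Δ'}P/(qr)`, `m₂ ≤ 1`
  gives the uniform bound with constant `4` as soon as `P = s₁t₁s₂t₂ ≥ x^{1/5}` (and `P ≤ 2x^{403/100}`, i.e. a non-empty hyperbola).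
Proof only (def-free helper); K_A NOT proved; nothing about Landau–Siegel zeros.
-/

noncomputable section

open scoped Real Nat
open Complex Finset Polynomial MeasureTheory
open Literature.NumberTheory.LFunctions

namespace Summit.Parity.GeneralizedHardyLittlewood.Theorems.MomentsBeyondDiagonal.Layers

open Summit.Parity.GeneralizedHardyLittlewood.Theorems.PrimeLevelFamEdgeIdeaDeltas.PeterssonLayers

/-- `√(Z₁Z₂) ≤ x^{Δ'}/√(d₁d₂·s₁s₂)` for the flat mollifier box `Zᵢ = ⌊x^{Δ'}⌋/dᵢ/sᵢ`. [folklore] -/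
theorem sqrt_flatBox_le {x Δ' : ℝ} (hx : 0 < x) {d₁ d₂ s₁ s₂ : ℕ} (hd₁ : 1 ≤ d₁) (hd₂ : 1 ≤ d₂)
    (hs₁ : 1 ≤ s₁) (hs₂ : 1 ≤ s₂) :
    Real.sqrt (((⌊x ^ Δ'⌋₊ / d₁ / s₁ : ℕ) : ℝ) * ((⌊x ^ Δ'⌋₊ / d₂ / s₂ : ℕ) : ℝ)) ≤
      x ^ Δ' / Real.sqrt (((d₁ : ℝ) * d₂) * ((s₁ : ℝ) * s₂)) := by
  have hMx : ((⌊x ^ Δ'⌋₊ : ℕ) : ℝ) ≤ x ^ Δ' := Nat.floor_le (Real.rpow_nonneg hx.le _)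
  have hZ₁ : ((⌊x ^ Δ'⌋₊ / d₁ / s₁ : ℕ) : ℝ) ≤ x ^ Δ' / ((d₁ : ℝ) * s₁) :=
    (cast_div_div_le _ d₁ s₁).trans (div_le_div_of_nonneg_right hMx (by positivity))
  have hZ₂ : ((⌊x ^ Δ'⌋₊ / d₂ / s₂ : ℕ) : ℝ) ≤ x ^ Δ' / ((d₂ : ℝ) * s₂) :=
    (cast_div_div_le _ d₂ s₂).trans (div_le_div_of_nonneg_right hMx (by positivity))
  have hD : (0 : ℝ) < ((d₁ : ℝ) * d₂) * ((s₁ : ℝ) * s₂) := by positivity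
  have hxΔ : 0 ≤ x ^ Δ' := Real.rpow_nonneg hx.le _
  rw [Real.sqrt_le_left (by positivity), div_pow, Real.sq_sqrt hD.le]
  calc ((⌊x ^ Δ'⌋₊ / d₁ / s₁ : ℕ) : ℝ) * ((⌊x ^ Δ'⌋₊ / d₂ / s₂ : ℕ) : ℝ)
      ≤ (x ^ Δ' / ((d₁ : ℝ) * s₁)) * (x ^ Δ' / ((d₂ : ℝ) * s₂)) :=
        mul_le_mul hZ₁ hZ₂ (Nat.cast_nonneg _) (by positivity)
    _ = (x ^ Δ') ^ 2 / (((d₁ : ℝ) * d₂) * ((s₁ : ℝ) * s₂)) := by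
        rw [div_mul_div_comm, ← pow_two]
        congr 1
        ring

/-- `√((1+2log q)·Y/((d₁t₁)(d₂t₂))) ≤ √(1+2log q)·(√2·x^{1+η/2})/√(d₁d₂·t₁t₂)` (`Y = ⌈x^{2+η}⌉ ≤ 2x^{2+η}`, `q ≥ 64`,
`η ≥ 0`). [folklore] -/
theorem sqrt_afeBox_le {q : ℕ} [NeZero q] (h64 : 64 ≤ q) {η : ℝ} (hη0 : 0 ≤ η) {d₁ d₂ t₁ t₂ : ℕ}
    (hd₁ : 1 ≤ d₁) (hd₂ : 1 ≤ d₂) (ht₁ : 1 ≤ t₁) (ht₂ : 1 ≤ t₂) :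
    Real.sqrt ((1 + 2 * Real.log q) * (((⌈KMV2000.qhat q ^ (2 + η)⌉₊ : ℕ) : ℝ) /
        (((d₁ * t₁ : ℕ) : ℝ) * ((d₂ * t₂ : ℕ) : ℝ)))) ≤
      Real.sqrt (1 + 2 * Real.log q) * (Real.sqrt 2 * KMV2000.qhat q ^ (1 + η / 2)) /
        Real.sqrt (((d₁ : ℝ) * d₂) * ((t₁ : ℝ) * t₂)) := by
  have hqh1 : 1 < KMV2000.qhat q := one_lt_qhat h64
  have hqh0 : 0 < KMV2000.qhat q := zero_lt_one.trans hqh1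
  set x : ℝ := KMV2000.qhat q with hx
  have hlq : 0 ≤ Real.log (q : ℝ) := Real.log_nonneg (by exact_mod_cast (le_trans (by norm_num) h64 : 1 ≤ q))
  have hlog : 0 ≤ 1 + 2 * Real.log q := by linarith
  have hY : ((⌈x ^ (2 + η)⌉₊ : ℕ) : ℝ) ≤ 2 * x ^ (2 + η) := natCeil_le_two_mul (Real.one_le_rpow hqh1.le (by linarith))
  have hsY : Real.sqrt (((⌈x ^ (2 + η)⌉₊ : ℕ) : ℝ)) ≤ Real.sqrt 2 * x ^ (1 + η / 2) := by
    rw [Real.sqrt_le_left (by positivity), mul_pow, Real.sq_sqrt (by norm_num), ← Real.rpow_natCast (x ^ (1 + η / 2)) 2,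
      ← Real.rpow_mul hqh0.le]
    convert hY using 3
    push_cast
    ring
  have hD : ((d₁ * t₁ : ℕ) : ℝ) * ((d₂ * t₂ : ℕ) : ℝ) = ((d₁ : ℝ) * d₂) * ((t₁ : ℝ) * t₂) := by push_cast; ring
  rw [hD, Real.sqrt_mul hlog, Real.sqrt_div' _ (by positivity), mul_div_assoc]
  exact mul_le_mul_of_nonneg_left (div_le_div_of_nonneg_right hsY (Real.sqrt_nonneg _)) (Real.sqrt_nonneg _)

/-- `u^{1/3}·g^{1/6} ≤ P^{5/12}` for `0 ≤ u ≤ P`, `0 ≤ g`, `g² ≤ P`, `P > 0`. [folklore] -/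
theorem weight_key_le {u g P : ℝ} (hu0 : 0 ≤ u) (hg0 : 0 ≤ g) (hP : 0 < P) (hu : u ≤ P) (hg : g ^ 2 ≤ P) :
    u ^ (1 / 3 : ℝ) * g ^ (1 / 6 : ℝ) ≤ P ^ (5 / 12 : ℝ) := by
  have h1 : u ^ (1 / 3 : ℝ) ≤ P ^ (1 / 3 : ℝ) := Real.rpow_le_rpow hu0 hu (by norm_num)
  have h2 : g ^ (1 / 6 : ℝ) ≤ P ^ (1 / 12 : ℝ) := by
    have e : g ^ (1 / 6 : ℝ) = (g ^ 2) ^ (1 / 12 : ℝ) := by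
      rw [← Real.rpow_natCast g 2, ← Real.rpow_mul hg0]; norm_num
    rw [e]; exact Real.rpow_le_rpow (by positivity) hg (by norm_num)
  calc u ^ (1 / 3 : ℝ) * g ^ (1 / 6 : ℝ) ≤ P ^ (1 / 3 : ℝ) * P ^ (1 / 12 : ℝ) :=
        mul_le_mul h1 h2 (by positivity) (by positivity)
    _ = P ^ (5 / 12 : ℝ) := by rw [← Real.rpow_add hP]; norm_num

/-- `√(m+1) ≤ √m + 1` for `m ≥ 0`. [folklore] -/
theorem sqrt_add_one_le {m : ℝ} (hm : 0 ≤ m) : Real.sqrt (m + 1) ≤ Real.sqrt m + 1 := by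
  rw [Real.sqrt_le_left (by positivity)]
  nlinarith [Real.sq_sqrt hm, Real.sqrt_nonneg m]

/-- `3^{1/6}·√2 ≤ 6`. [folklore] -/
theorem three_rpow_sixth_mul_sqrt_two_le : (3 : ℝ) ^ (1 / 6 : ℝ) * Real.sqrt 2 ≤ 6 := by
  have h1 : (3 : ℝ) ^ (1 / 6 : ℝ) ≤ 3 := by
    calc (3 : ℝ) ^ (1 / 6 : ℝ) ≤ (3 : ℝ) ^ (1 : ℝ) := Real.rpow_le_rpow_of_exponent_le (by norm_num) (by norm_num)
      _ = 3 := Real.rpow_one _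
  have h2 : Real.sqrt 2 ≤ 2 := by
    rw [Real.sqrt_le_left (by norm_num)]; norm_num
  calc (3 : ℝ) ^ (1 / 6 : ℝ) * Real.sqrt 2 ≤ 3 * 2 := mul_le_mul h1 h2 (Real.sqrt_nonneg _) (by norm_num)
    _ = 6 := by norm_num

/-- `9 ≤ π²`. [folklore] -/
theorem nine_le_pi_sq : (9 : ℝ) ≤ π ^ 2 := by nlinarith [Real.pi_gt_three, Real.pi_pos]

/-- `√(d₁d₂·s₁s₂)·√(d₁d₂·t₁t₂) = d₁d₂·P^{1/2}`, `P = s₁t₁s₂t₂`. [folklore] -/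
theorem sqrt_boxes_mul_eq {d₁ d₂ s₁ s₂ t₁ t₂ : ℕ} :
    Real.sqrt (((d₁ : ℝ) * d₂) * ((s₁ : ℝ) * s₂)) * Real.sqrt (((d₁ : ℝ) * d₂) * ((t₁ : ℝ) * t₂)) =
      ((d₁ : ℝ) * d₂) * (((s₁ * t₁ * (s₂ * t₂) : ℕ) : ℝ)) ^ (1 / 2 : ℝ) := by
  have ha : (0 : ℝ) ≤ (d₁ : ℝ) * d₂ := by positivity
  rw [← Real.sqrt_mul (by positivity),
    show ((d₁ : ℝ) * d₂) * ((s₁ : ℝ) * s₂) * (((d₁ : ℝ) * d₂) * ((t₁ : ℝ) * t₂)) =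
      ((d₁ : ℝ) * d₂) * ((d₁ : ℝ) * d₂) * (((s₁ * t₁ * (s₂ * t₂) : ℕ) : ℝ)) by push_cast; ring,
    Real.sqrt_mul (by positivity), Real.sqrt_mul_self ha, Real.sqrt_eq_rpow]

/-- **The Pascadi kernel factor against the uniform weight** (`x = q̂`, `q ≥ 64`; class data `dᵢ, sᵢ, tᵢ, g ≥ 1` with `g ∣ s₁t₁`,
`g ∣ s₂t₂`, `g ∣ qr`; `0 ≤ u ≤ P = s₁t₁s₂t₂`; `0 ≤ bracket ≤ 3u²g·x^{−13/100}`; `ε ≥ 0`):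
`√(Z₁Z₂)·√((1+2log q)Y/(d₁t₁d₂t₂))·(g·(qr/g)^{1+ε})·bracket^{1/6} ≤ 6√(1+2log q)·x^{Δ'+1+η/2−13/600}·(qr)^{1+ε}/(d₁d₂)·P^{−1/12}`.
[folklore] -/
theorem pascadi_weight_le {q : ℕ} [NeZero q] (h64 : 64 ≤ q) {Δ' η ε : ℝ} (hη0 : 0 ≤ η) (hε : 0 ≤ ε)
    {r d₁ d₂ s₁ s₂ t₁ t₂ g : ℕ} (hd₁ : 1 ≤ d₁) (hd₂ : 1 ≤ d₂) (hs₁ : 1 ≤ s₁) (hs₂ : 1 ≤ s₂) (ht₁ : 1 ≤ t₁)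
    (ht₂ : 1 ≤ t₂) (hg0 : 1 ≤ g) (hg₁ : g ∣ s₁ * t₁) (hg₂ : g ∣ s₂ * t₂) (hgc : g ∣ q * r)
    {u : ℝ} (hu0 : 0 ≤ u) (hu : u ≤ ((s₁ * t₁ * (s₂ * t₂) : ℕ) : ℝ))
    {br : ℝ} (hbr0 : 0 ≤ br) (hbr : br ≤ 3 * u ^ 2 * g * KMV2000.qhat q ^ (-(13 / 100 : ℝ))) :
    Real.sqrt (((⌊KMV2000.qhat q ^ Δ'⌋₊ / d₁ / s₁ : ℕ) : ℝ) * ((⌊KMV2000.qhat q ^ Δ'⌋₊ / d₂ / s₂ : ℕ) : ℝ)) *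
        Real.sqrt ((1 + 2 * Real.log q) * (((⌈KMV2000.qhat q ^ (2 + η)⌉₊ : ℕ) : ℝ) /
          (((d₁ * t₁ : ℕ) : ℝ) * ((d₂ * t₂ : ℕ) : ℝ)))) *
        ((g : ℝ) * ((q * r / g : ℕ) : ℝ) ^ (1 + ε)) * br ^ (1 / 6 : ℝ) ≤
      6 * Real.sqrt (1 + 2 * Real.log q) * KMV2000.qhat q ^ (Δ' + 1 + η / 2 - 13 / 600) *
        ((q : ℝ) * r) ^ (1 + ε) / ((d₁ : ℝ) * d₂) * (((s₁ * t₁ * (s₂ * t₂) : ℕ) : ℝ)) ^ (-(1 / 12 : ℝ)) := by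
  have hqh1 : 1 < KMV2000.qhat q := one_lt_qhat h64
  have hqh0 : 0 < KMV2000.qhat q := zero_lt_one.trans hqh1
  set x : ℝ := KMV2000.qhat q with hx
  set P : ℝ := (((s₁ * t₁ * (s₂ * t₂) : ℕ) : ℝ)) with hPdef
  have hP1 : 1 ≤ P := by
    rw [hPdef]; exact_mod_cast Nat.one_le_iff_ne_zero.mpr (by positivity)
  have hP0 : 0 < P := by linarith
  set a : ℝ := (d₁ : ℝ) * d₂ with ha
  have ha0 : 0 < a := by rw [ha]; positivity
  have hlq : 0 ≤ Real.log (q : ℝ) := Real.log_nonneg (by exact_mod_cast (le_trans (by norm_num) h64 : 1 ≤ q))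
  have hlog : 0 ≤ 1 + 2 * Real.log q := by linarith
  -- the four factors
  have hF1 : Real.sqrt (((⌊x ^ Δ'⌋₊ / d₁ / s₁ : ℕ) : ℝ) * ((⌊x ^ Δ'⌋₊ / d₂ / s₂ : ℕ) : ℝ)) ≤
      x ^ Δ' / Real.sqrt (a * ((s₁ : ℝ) * s₂)) := sqrt_flatBox_le (Δ' := Δ') hqh0 hd₁ hd₂ hs₁ hs₂
  have hF2 : Real.sqrt ((1 + 2 * Real.log q) * (((⌈x ^ (2 + η)⌉₊ : ℕ) : ℝ) /
      (((d₁ * t₁ : ℕ) : ℝ) * ((d₂ * t₂ : ℕ) : ℝ)))) ≤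
      Real.sqrt (1 + 2 * Real.log q) * (Real.sqrt 2 * x ^ (1 + η / 2)) / Real.sqrt (a * ((t₁ : ℝ) * t₂)) :=
    sqrt_afeBox_le h64 hη0 hd₁ hd₂ ht₁ ht₂
  have hF3 : (g : ℝ) * ((q * r / g : ℕ) : ℝ) ^ (1 + ε) ≤ ((q : ℝ) * r) ^ (1 + ε) := by
    have h := mul_rpow_div_le (c := q * r) hgc (by omega) hε
    push_cast at h
    exact h
  have hF4 : br ^ (1 / 6 : ℝ) ≤ (3 : ℝ) ^ (1 / 6 : ℝ) * (u ^ (1 / 3 : ℝ) * (g : ℝ) ^ (1 / 6 : ℝ)) * x ^ (-(13 / 600 : ℝ)) := by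
    calc br ^ (1 / 6 : ℝ) ≤ (3 * u ^ 2 * g * x ^ (-(13 / 100 : ℝ))) ^ (1 / 6 : ℝ) :=
          Real.rpow_le_rpow hbr0 hbr (by norm_num)
      _ = (3 : ℝ) ^ (1 / 6 : ℝ) * (u ^ (1 / 3 : ℝ) * (g : ℝ) ^ (1 / 6 : ℝ)) * x ^ (-(13 / 600 : ℝ)) := by
          rw [Real.mul_rpow (by positivity) (Real.rpow_nonneg hqh0.le _), Real.mul_rpow (by positivity) (by positivity),
            Real.mul_rpow (by norm_num) (by positivity), ← Real.rpow_natCast u 2, ← Real.rpow_mul hu0,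
            ← Real.rpow_mul hqh0.le, show ((2 : ℕ) : ℝ) * (1 / 6 : ℝ) = 1 / 3 by norm_num,
            show (-(13 / 100 : ℝ)) * (1 / 6 : ℝ) = -(13 / 600 : ℝ) by norm_num]
          ring
  -- the key weight inequality
  have hg2 : ((g : ℝ)) ^ 2 ≤ P := by
    rw [hPdef]
    have h : g * g ≤ s₁ * t₁ * (s₂ * t₂) :=
      Nat.mul_le_mul (Nat.le_of_dvd (by positivity) hg₁) (Nat.le_of_dvd (by positivity) hg₂)
    have h' : g ^ 2 ≤ s₁ * t₁ * (s₂ * t₂) := by rw [pow_two]; exact h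
    exact_mod_cast h'
  have hkey := weight_key_le hu0 (Nat.cast_nonneg g) hP0 hu hg2
  have hsq := sqrt_boxes_mul_eq (d₁ := d₁) (d₂ := d₂) (s₁ := s₁) (s₂ := s₂) (t₁ := t₁) (t₂ := t₂)
  have hx3 : x ^ Δ' * x ^ (1 + η / 2) * x ^ (-(13 / 600 : ℝ)) = x ^ (Δ' + 1 + η / 2 - 13 / 600) := by
    rw [← Real.rpow_add hqh0, ← Real.rpow_add hqh0]; ring_nf
  have hS0 : 0 < Real.sqrt (a * ((s₁ : ℝ) * s₂)) := Real.sqrt_pos.mpr (by positivity)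
  have hT0 : 0 < Real.sqrt (a * ((t₁ : ℝ) * t₂)) := Real.sqrt_pos.mpr (by positivity)
  calc _ ≤ (x ^ Δ' / Real.sqrt (a * ((s₁ : ℝ) * s₂))) *
        (Real.sqrt (1 + 2 * Real.log q) * (Real.sqrt 2 * x ^ (1 + η / 2)) / Real.sqrt (a * ((t₁ : ℝ) * t₂))) *
        ((q : ℝ) * r) ^ (1 + ε) *
        ((3 : ℝ) ^ (1 / 6 : ℝ) * (u ^ (1 / 3 : ℝ) * (g : ℝ) ^ (1 / 6 : ℝ)) * x ^ (-(13 / 600 : ℝ))) :=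
          mul_le_mul (mul_le_mul (mul_le_mul hF1 hF2 (Real.sqrt_nonneg _) (by positivity)) hF3 (by positivity)
            (by positivity)) hF4 (Real.rpow_nonneg hbr0 _) (by positivity)
    _ = ((3 : ℝ) ^ (1 / 6 : ℝ) * Real.sqrt 2) * Real.sqrt (1 + 2 * Real.log q) *
        (x ^ Δ' * x ^ (1 + η / 2) * x ^ (-(13 / 600 : ℝ))) * ((q : ℝ) * r) ^ (1 + ε) *
        ((u ^ (1 / 3 : ℝ) * (g : ℝ) ^ (1 / 6 : ℝ)) /
          (Real.sqrt (a * ((s₁ : ℝ) * s₂)) * Real.sqrt (a * ((t₁ : ℝ) * t₂)))) := by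
          ring
    _ ≤ 6 * Real.sqrt (1 + 2 * Real.log q) * x ^ (Δ' + 1 + η / 2 - 13 / 600) * ((q : ℝ) * r) ^ (1 + ε) *
        (P ^ (5 / 12 : ℝ) / (a * P ^ (1 / 2 : ℝ))) := by
          rw [hx3, hsq]
          gcongr
          exact three_rpow_sixth_mul_sqrt_two_le
    _ = _ := by
          have e : P ^ (5 / 12 : ℝ) / (a * P ^ (1 / 2 : ℝ)) = P ^ (-(1 / 12) : ℝ) / a := by
            rw [show (5 / 12 : ℝ) = -(1 / 12) + 1 / 2 by norm_num, Real.rpow_add hP0]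
            exact mul_div_mul_right _ _ (Real.rpow_pos_of_pos hP0 _).ne'
          rw [e]
          ring

/-- **The dilated-Parseval kernel factor against the uniform weight** (`x = q̂`, `q ≥ 64`, `x^{11/10} < r`, `Δ' ≤ 101/100`,
`η ≥ 0`, `ε ≥ 0`; class data `≥ 1`, `g ∣ qr`; multiplicities `m₁ ≤ x^{2Δ'}P/(qr)`, `m₂ ≤ 1`; `x^{1/5} ≤ P = s₁t₁s₂t₂ ≤ 2x^{403/100}`):
`g·(qr/g)·√(m₁+1)·√(m₂+1)·√(Z₁Z₂)·√((1+2log q)Y/(d₁t₁d₂t₂)) ≤ 4√(1+2log q)·x^{Δ'+1+η/2−13/600}·(qr)^{1+ε}/(d₁d₂)·P^{−1/12}`.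
[cite: KerrShparlinskiWuXi2023, §1.1 (the trivial Fourier bound)] -/
theorem fourier_weight_le {q : ℕ} [NeZero q] (h64 : 64 ≤ q) {Δ' η ε : ℝ} (hΔ' : Δ' ≤ 101 / 100) (hη0 : 0 ≤ η)
    (hε : 0 ≤ ε) {r : ℕ} (hr : KMV2000.qhat q ^ (11 / 10 : ℝ) < r)
    {d₁ d₂ s₁ s₂ t₁ t₂ g : ℕ} (hd₁ : 1 ≤ d₁) (hd₂ : 1 ≤ d₂) (hs₁ : 1 ≤ s₁) (hs₂ : 1 ≤ s₂) (ht₁ : 1 ≤ t₁)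
    (ht₂ : 1 ≤ t₂) (hg0 : 1 ≤ g) (hgc : g ∣ q * r) {m₁ m₂ : ℕ}
    (hm₁ : (m₁ : ℝ) ≤ KMV2000.qhat q ^ (2 * Δ') * (((s₁ * t₁ * (s₂ * t₂) : ℕ) : ℝ)) / ((q : ℝ) * r))
    (hm₂ : m₂ ≤ 1) (hPlo : KMV2000.qhat q ^ (1 / 5 : ℝ) ≤ (((s₁ * t₁ * (s₂ * t₂) : ℕ) : ℝ)))
    (hPhi : (((s₁ * t₁ * (s₂ * t₂) : ℕ) : ℝ)) ≤ 2 * KMV2000.qhat q ^ (403 / 100 : ℝ)) :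
    (g : ℝ) * ((q * r / g : ℕ) : ℝ) * Real.sqrt (((m₁ + 1 : ℕ)) : ℝ) * Real.sqrt (((m₂ + 1 : ℕ)) : ℝ) *
        Real.sqrt (((⌊KMV2000.qhat q ^ Δ'⌋₊ / d₁ / s₁ : ℕ) : ℝ) * ((⌊KMV2000.qhat q ^ Δ'⌋₊ / d₂ / s₂ : ℕ) : ℝ)) *
        Real.sqrt ((1 + 2 * Real.log q) * (((⌈KMV2000.qhat q ^ (2 + η)⌉₊ : ℕ) : ℝ) /
          (((d₁ * t₁ : ℕ) : ℝ) * ((d₂ * t₂ : ℕ) : ℝ)))) ≤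
      4 * Real.sqrt (1 + 2 * Real.log q) * KMV2000.qhat q ^ (Δ' + 1 + η / 2 - 13 / 600) *
        ((q : ℝ) * r) ^ (1 + ε) / ((d₁ : ℝ) * d₂) * (((s₁ * t₁ * (s₂ * t₂) : ℕ) : ℝ)) ^ (-(1 / 12 : ℝ)) := by
  have hqh1 : 1 < KMV2000.qhat q := one_lt_qhat h64
  have hqh0 : 0 < KMV2000.qhat q := zero_lt_one.trans hqh1
  set x : ℝ := KMV2000.qhat q with hx
  set P : ℝ := (((s₁ * t₁ * (s₂ * t₂) : ℕ) : ℝ)) with hPdef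
  have hP1 : 1 ≤ P := by
    rw [hPdef]; exact_mod_cast Nat.one_le_iff_ne_zero.mpr (by positivity)
  have hP0 : 0 < P := by linarith
  set a : ℝ := (d₁ : ℝ) * d₂ with ha
  have ha0 : 0 < a := by rw [ha]; positivity
  have ha1 : 1 ≤ a := by rw [ha]; exact_mod_cast Nat.one_le_iff_ne_zero.mpr (by positivity)
  have hlq : 0 ≤ Real.log (q : ℝ) := Real.log_nonneg (by exact_mod_cast (le_trans (by norm_num) h64 : 1 ≤ q))
  have hlog : 0 ≤ 1 + 2 * Real.log q := by linarith
  have hr0 : (0 : ℝ) < r := lt_trans (Real.rpow_pos_of_pos hqh0 _) hr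
  have hq : (q : ℝ) = 4 * π ^ 2 * x ^ 2 := by rw [hx]; exact natCast_eq_four_pi_sq_mul_qhat_sq q
  have hq0 : (0 : ℝ) < q := by rw [hq]; positivity
  set Q : ℝ := (q : ℝ) * r with hQ
  have hQ0 : 0 < Q := by rw [hQ]; positivity
  -- `g · (qr/g) = qr`
  have hgc' : (g : ℝ) * ((q * r / g : ℕ) : ℝ) = Q := by
    have hg0' : (g : ℝ) ≠ 0 := by exact_mod_cast (by omega : g ≠ 0)
    rw [Nat.cast_div hgc hg0']; push_cast; rw [hQ]; field_simp
  -- the multiplicities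
  have hsm₁ : Real.sqrt (((m₁ + 1 : ℕ)) : ℝ) ≤ Real.sqrt m₁ + 1 := by
    push_cast; exact sqrt_add_one_le (Nat.cast_nonneg _)
  have hsm₂ : Real.sqrt (((m₂ + 1 : ℕ)) : ℝ) ≤ Real.sqrt 2 := by
    refine Real.sqrt_le_sqrt ?_
    have : ((m₂ : ℕ) : ℝ) ≤ 1 := by exact_mod_cast hm₂
    push_cast; linarith
  have hF1 : Real.sqrt (((⌊x ^ Δ'⌋₊ / d₁ / s₁ : ℕ) : ℝ) * ((⌊x ^ Δ'⌋₊ / d₂ / s₂ : ℕ) : ℝ)) ≤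
      x ^ Δ' / Real.sqrt (a * ((s₁ : ℝ) * s₂)) := sqrt_flatBox_le (Δ' := Δ') hqh0 hd₁ hd₂ hs₁ hs₂
  have hF2 : Real.sqrt ((1 + 2 * Real.log q) * (((⌈x ^ (2 + η)⌉₊ : ℕ) : ℝ) /
      (((d₁ * t₁ : ℕ) : ℝ) * ((d₂ * t₂ : ℕ) : ℝ)))) ≤
      Real.sqrt (1 + 2 * Real.log q) * (Real.sqrt 2 * x ^ (1 + η / 2)) / Real.sqrt (a * ((t₁ : ℝ) * t₂)) :=
    sqrt_afeBox_le h64 hη0 hd₁ hd₂ ht₁ ht₂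
  have hsq := sqrt_boxes_mul_eq (d₁ := d₁) (d₂ := d₂) (s₁ := s₁) (s₂ := s₂) (t₁ := t₁) (t₂ := t₂)
  have hS0 : 0 < Real.sqrt (a * ((s₁ : ℝ) * s₂)) := Real.sqrt_pos.mpr (by positivity)
  have hT0 : 0 < Real.sqrt (a * ((t₁ : ℝ) * t₂)) := Real.sqrt_pos.mpr (by positivity)
  have hx2 : x ^ Δ' * x ^ (1 + η / 2) = x ^ (Δ' + 1 + η / 2) := by
    rw [← Real.rpow_add hqh0]; ring_nf
  -- Step 1: the product of the elementary bounds
  have h1 : (g : ℝ) * ((q * r / g : ℕ) : ℝ) * Real.sqrt (((m₁ + 1 : ℕ)) : ℝ) * Real.sqrt (((m₂ + 1 : ℕ)) : ℝ) *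
        Real.sqrt (((⌊x ^ Δ'⌋₊ / d₁ / s₁ : ℕ) : ℝ) * ((⌊x ^ Δ'⌋₊ / d₂ / s₂ : ℕ) : ℝ)) *
        Real.sqrt ((1 + 2 * Real.log q) * (((⌈x ^ (2 + η)⌉₊ : ℕ) : ℝ) / (((d₁ * t₁ : ℕ) : ℝ) * ((d₂ * t₂ : ℕ) : ℝ)))) ≤
      Q * (Real.sqrt m₁ + 1) * Real.sqrt 2 * (x ^ Δ' / Real.sqrt (a * ((s₁ : ℝ) * s₂))) *
        (Real.sqrt (1 + 2 * Real.log q) * (Real.sqrt 2 * x ^ (1 + η / 2)) / Real.sqrt (a * ((t₁ : ℝ) * t₂))) := by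
    rw [hgc']
    have hA : Q * Real.sqrt (((m₁ + 1 : ℕ)) : ℝ) * Real.sqrt (((m₂ + 1 : ℕ)) : ℝ) ≤
        Q * (Real.sqrt m₁ + 1) * Real.sqrt 2 :=
      mul_le_mul (mul_le_mul_of_nonneg_left hsm₁ hQ0.le) hsm₂ (Real.sqrt_nonneg _) (by positivity)
    exact mul_le_mul (mul_le_mul hA hF1 (Real.sqrt_nonneg _) (by positivity)) hF2 (Real.sqrt_nonneg _)
      (by positivity)
  refine h1.trans ?_
  -- Step 2: rewrite the product
  have e1 : Q * (Real.sqrt m₁ + 1) * Real.sqrt 2 * (x ^ Δ' / Real.sqrt (a * ((s₁ : ℝ) * s₂))) *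
        (Real.sqrt (1 + 2 * Real.log q) * (Real.sqrt 2 * x ^ (1 + η / 2)) / Real.sqrt (a * ((t₁ : ℝ) * t₂))) =
      2 * Real.sqrt (1 + 2 * Real.log q) * x ^ (Δ' + 1 + η / 2) *
        ((Q * Real.sqrt m₁ + Q) / (a * P ^ (1 / 2 : ℝ))) := by
    have h22 : Real.sqrt 2 * Real.sqrt 2 = 2 := Real.mul_self_sqrt (by norm_num)
    rw [← hx2, ← hsq]
    calc _ = (Real.sqrt 2 * Real.sqrt 2) * Real.sqrt (1 + 2 * Real.log q) * (x ^ Δ' * x ^ (1 + η / 2)) *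
          ((Q * Real.sqrt m₁ + Q) / (Real.sqrt (a * ((s₁ : ℝ) * s₂)) * Real.sqrt (a * ((t₁ : ℝ) * t₂)))) := by
            ring
      _ = _ := by rw [h22]
  rw [e1]
  -- Step 3: the two terms
  have hQ1 : 1 ≤ Q := by
    rw [hQ, hq]
    have h1r : (1 : ℝ) ≤ r := by exact_mod_cast Nat.one_le_iff_ne_zero.mpr (by rintro rfl; simp at hr0)
    have hπ2 : (9 : ℝ) ≤ π ^ 2 := nine_le_pi_sq
    have hx2' : (1 : ℝ) ≤ x ^ 2 := one_le_pow₀ hqh1.le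
    have h36 : (1 : ℝ) ≤ 4 * π ^ 2 * x ^ 2 := by
      calc (1 : ℝ) ≤ 4 * 9 * 1 := by norm_num
        _ ≤ 4 * π ^ 2 * x ^ 2 := by gcongr
    exact one_le_mul_of_one_le_of_one_le h36 h1r
  have hQε : Q ≤ Q ^ (1 + ε) := Real.self_le_rpow_of_one_le hQ1 (by linarith)
  have hx13 : 0 < x ^ (-(13 / 600 : ℝ)) := Real.rpow_pos_of_pos hqh0 _
  -- (T_B) `Q ≤ x^{-13/600} Q^{1+ε} P^{-1/12} P^{1/2}`
  have hTB : Q ≤ x ^ (-(13 / 600 : ℝ)) * Q ^ (1 + ε) * (P ^ (-(1 / 12) : ℝ) * P ^ (1 / 2 : ℝ)) := by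
    have hP5 : 1 ≤ x ^ (-(13 / 600 : ℝ)) * (P ^ (-(1 / 12) : ℝ) * P ^ (1 / 2 : ℝ)) := by
      rw [← Real.rpow_add hP0, show (-(1 / 12) + 1 / 2 : ℝ) = 5 / 12 by norm_num]
      have h1 : x ^ (1 / 12 : ℝ) ≤ P ^ (5 / 12 : ℝ) := by
        calc x ^ (1 / 12 : ℝ) = (x ^ (1 / 5 : ℝ)) ^ (5 / 12 : ℝ) := by rw [← Real.rpow_mul hqh0.le]; norm_num
          _ ≤ P ^ (5 / 12 : ℝ) := Real.rpow_le_rpow (Real.rpow_nonneg hqh0.le _) hPlo (by norm_num)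
      have h2 : 1 ≤ x ^ (-(13 / 600 : ℝ)) * x ^ (1 / 12 : ℝ) := by
        rw [← Real.rpow_add hqh0]; exact Real.one_le_rpow hqh1.le (by norm_num)
      exact h2.trans (mul_le_mul_of_nonneg_left h1 hx13.le)
    calc Q = Q * 1 := (mul_one _).symm
      _ ≤ Q ^ (1 + ε) * (x ^ (-(13 / 600 : ℝ)) * (P ^ (-(1 / 12) : ℝ) * P ^ (1 / 2 : ℝ))) :=
          mul_le_mul hQε hP5 (by norm_num) (by positivity)
      _ = _ := by ring
  -- (T_A) `Q √m₁ ≤ x^{-13/600} Q^{1+ε} P^{-1/12} P^{1/2}`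
  have hTA : Q * Real.sqrt m₁ ≤ x ^ (-(13 / 600 : ℝ)) * Q ^ (1 + ε) * (P ^ (-(1 / 12) : ℝ) * P ^ (1 / 2 : ℝ)) := by
    -- `√m₁ ≤ x^{Δ'} √P / √Q`
    have hsm : Real.sqrt m₁ ≤ x ^ Δ' * Real.sqrt P / Real.sqrt Q := by
      have h := Real.sqrt_le_sqrt hm₁
      rw [Real.sqrt_div' _ hQ0.le, Real.sqrt_mul (Real.rpow_nonneg hqh0.le _),
        show x ^ (2 * Δ') = (x ^ Δ') ^ 2 by rw [← Real.rpow_natCast, ← Real.rpow_mul hqh0.le]; ring_nf,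
        Real.sqrt_sq (Real.rpow_nonneg hqh0.le _)] at h
      exact h
    have hsQ : 0 < Real.sqrt Q := Real.sqrt_pos.mpr hQ0
    -- `x^{Δ'+13/600} P^{1/12} ≤ √Q`
    have hP12 : P ^ (1 / 12 : ℝ) ≤ 2 * x ^ (34 / 100 : ℝ) := by
      calc P ^ (1 / 12 : ℝ) ≤ (2 * x ^ (403 / 100 : ℝ)) ^ (1 / 12 : ℝ) := Real.rpow_le_rpow hP0.le hPhi (by norm_num)
        _ = (2 : ℝ) ^ (1 / 12 : ℝ) * x ^ (403 / 1200 : ℝ) := by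
            rw [Real.mul_rpow (by norm_num) (Real.rpow_nonneg hqh0.le _), ← Real.rpow_mul hqh0.le]; norm_num
        _ ≤ 2 * x ^ (34 / 100 : ℝ) := by
            refine mul_le_mul ?_ (Real.rpow_le_rpow_of_exponent_le hqh1.le (by norm_num)) (Real.rpow_nonneg hqh0.le _)
              (by norm_num)
            calc (2 : ℝ) ^ (1 / 12 : ℝ) ≤ (2 : ℝ) ^ (1 : ℝ) := Real.rpow_le_rpow_of_exponent_le (by norm_num) (by norm_num)
              _ = 2 := Real.rpow_one _
    have hmain : x ^ Δ' * x ^ (13 / 600 : ℝ) * P ^ (1 / 12 : ℝ) ≤ Real.sqrt Q := by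
      have hxe : x ^ Δ' * x ^ (13 / 600 : ℝ) ≤ x ^ (104 / 100 : ℝ) := by
        rw [← Real.rpow_add hqh0]; exact Real.rpow_le_rpow_of_exponent_le hqh1.le (by linarith)
      have hlhs : x ^ Δ' * x ^ (13 / 600 : ℝ) * P ^ (1 / 12 : ℝ) ≤ 2 * x ^ (138 / 100 : ℝ) := by
        calc _ ≤ x ^ (104 / 100 : ℝ) * (2 * x ^ (34 / 100 : ℝ)) :=
              mul_le_mul hxe hP12 (by positivity) (by positivity)
          _ = 2 * x ^ (138 / 100 : ℝ) := by
              rw [show (138 / 100 : ℝ) = 104 / 100 + 34 / 100 by norm_num, Real.rpow_add hqh0]; ring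
      have hrhs : 2 * x ^ (155 / 100 : ℝ) ≤ Real.sqrt Q := by
        rw [Real.le_sqrt (by positivity) hQ0.le, hQ, hq]
        have e : (2 * x ^ (155 / 100 : ℝ)) ^ 2 = 4 * (x ^ 2 * x ^ (11 / 10 : ℝ)) := by
          rw [mul_pow, ← Real.rpow_natCast (x ^ (155 / 100 : ℝ)) 2, ← Real.rpow_mul hqh0.le,
            ← Real.rpow_natCast x 2, ← Real.rpow_add hqh0]
          norm_num
        rw [e]
        have hπ : (4 : ℝ) ≤ 4 * π ^ 2 := by
          have h9 := nine_le_pi_sq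
          calc (4 : ℝ) = 4 * 1 := by norm_num
            _ ≤ 4 * π ^ 2 := mul_le_mul_of_nonneg_left (by linarith) (by norm_num)
        calc 4 * (x ^ 2 * x ^ (11 / 10 : ℝ)) ≤ 4 * π ^ 2 * (x ^ 2 * x ^ (11 / 10 : ℝ)) :=
              mul_le_mul_of_nonneg_right hπ (by positivity)
          _ ≤ 4 * π ^ 2 * (x ^ 2 * r) := by gcongr
          _ = 4 * π ^ 2 * x ^ 2 * r := by ring
      have hmid : 2 * x ^ (138 / 100 : ℝ) ≤ 2 * x ^ (155 / 100 : ℝ) :=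
        mul_le_mul_of_nonneg_left (Real.rpow_le_rpow_of_exponent_le hqh1.le (by norm_num)) (by norm_num)
      exact hlhs.trans (hmid.trans hrhs)
    -- assemble
    have hsQ' : 0 < x ^ (13 / 600 : ℝ) * P ^ (1 / 12 : ℝ) := by positivity
    have hxΔ : x ^ Δ' ≤ Real.sqrt Q * (x ^ (-(13 / 600 : ℝ)) * P ^ (-(1 / 12) : ℝ)) := by
      have h1 : x ^ Δ' ≤ Real.sqrt Q / (x ^ (13 / 600 : ℝ) * P ^ (1 / 12 : ℝ)) :=
        (le_div_iff₀ hsQ').mpr (by simpa [mul_assoc] using hmain)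
      rw [Real.rpow_neg hqh0.le, Real.rpow_neg hP0.le, ← mul_inv, ← div_eq_mul_inv]
      exact h1
    have e3 : Real.sqrt Q * (x ^ (-(13 / 600 : ℝ)) * P ^ (-(1 / 12) : ℝ)) * Real.sqrt P * Real.sqrt Q =
        x ^ (-(13 / 600 : ℝ)) * Q * (P ^ (-(1 / 12) : ℝ) * P ^ (1 / 2 : ℝ)) := by
      rw [Real.sqrt_eq_rpow P]
      calc _ = x ^ (-(13 / 600 : ℝ)) * (Real.sqrt Q * Real.sqrt Q) * (P ^ (-(1 / 12) : ℝ) * P ^ (1 / 2 : ℝ)) := by ring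
        _ = _ := by rw [Real.mul_self_sqrt hQ0.le]
    calc Q * Real.sqrt m₁ ≤ Q * (x ^ Δ' * Real.sqrt P / Real.sqrt Q) := mul_le_mul_of_nonneg_left hsm hQ0.le
      _ = x ^ Δ' * Real.sqrt P * (Q / Real.sqrt Q) := by ring
      _ = x ^ Δ' * Real.sqrt P * Real.sqrt Q := by rw [Real.div_sqrt]
      _ ≤ (Real.sqrt Q * (x ^ (-(13 / 600 : ℝ)) * P ^ (-(1 / 12) : ℝ))) * Real.sqrt P * Real.sqrt Q := by gcongr
      _ = x ^ (-(13 / 600 : ℝ)) * Q * (P ^ (-(1 / 12) : ℝ) * P ^ (1 / 2 : ℝ)) := e3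
      _ ≤ x ^ (-(13 / 600 : ℝ)) * Q ^ (1 + ε) * (P ^ (-(1 / 12) : ℝ) * P ^ (1 / 2 : ℝ)) := by gcongr
  calc 2 * Real.sqrt (1 + 2 * Real.log q) * x ^ (Δ' + 1 + η / 2) * ((Q * Real.sqrt m₁ + Q) / (a * P ^ (1 / 2 : ℝ)))
      ≤ 2 * Real.sqrt (1 + 2 * Real.log q) * x ^ (Δ' + 1 + η / 2) *
        ((2 * (x ^ (-(13 / 600 : ℝ)) * Q ^ (1 + ε) * (P ^ (-(1 / 12) : ℝ) * P ^ (1 / 2 : ℝ)))) / (a * P ^ (1 / 2 : ℝ))) := by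
          gcongr
          linarith
    _ = _ := by
          have e : x ^ (Δ' + 1 + η / 2) * x ^ (-(13 / 600 : ℝ)) = x ^ (Δ' + 1 + η / 2 - 13 / 600) := by
            rw [← Real.rpow_add hqh0]; ring_nf
          rw [← e]
          field_simp
          ring

end Summit.Parity.GeneralizedHardyLittlewood.Theorems.MomentsBeyondDiagonal.Layers

end
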